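import Summits.Ventures.QEC.Expanders.QuantumExpanderDecoderRadiusProjection
import HarnessLib

/-!
# Quantum expander codes: FGL18 Proposition 11 without the degree-ratio factor — every small-set-flip decoder with
# threshold `κ ≤ β̃·max(Δ_A,Δ_B)` corrects every error of weight `≤ (β̃/(1+β̃))·min(γ_A n_A, γ_B n_B)` — PROOF by the
# projection invariant

Index of sources: `[cite: FawziGrospellierLeverrier2018]` = Fawzi–Grospellier–Leverrier, STOC 2018 / arXiv:1711.08351v2: Def. 10
and Prop. 11 (§3.2, p0011 L4-24: "`t_SSF(β) ≥ (rβ/(1+β))·min(γ_A n_A, γ_B n_B)`", `r = d_A/d_B`), Remark 9 (p0011 L1-2),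
Lemma 24 and the proof of Prop. 11 (§7.1, p0018 L36 – p0019 L6: "`x + y ≤ 1` because `E_R` minimizes `‖·‖`";
"`d_A‖E‖ ≤ |E| ≤ d_B‖E‖`"; "`β d_B Σ|F_i| ≤ |σ_X(E_0)| − |σ_X(E_f)|`"); `[cite: LeverrierTillichZemor2015]` Lemma 7 / App. A
(arXiv:1504.00822v1 p0012: the projections `E_A²`, `E¹_{B,a}`).

Venture QEC (`Summits/Ventures/QEC/Expanders`), row 04 (`prover-qec-type-04`, gen 7), item «04.PROJ11» (placement under Summits:
a statement stronger than print). The printed/tree radius of Prop. 11 (`fgl18_proposition11_minmax_of_le`: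
`(min Δ/max Δ)·(β̃/(1+β̃))·min(γ_A n_A, γ_B n_B)`) carries the factor `r̃ = min Δ/max Δ` because the printed proof passes
from a reachable error `E_i` to its `‖·‖`-MINIMAL representative, whose Hamming weight may exceed `|E_i|` by `max Δ/min Δ`
(`d_A‖E‖ ≤ |E| ≤ d_B‖E‖`), before applying Lemma 7. With the projection form of Lemma 7
(`exists_isCritical_of_proj`) no global representative is needed: Lemma 24's inequality `Δ_A|x_a| + Δ_B|x_b| ≤ Δ_AΔ_B` is
LOCAL `‖·‖`-minimality at the critical generator `g_{ba}` — automatic in the degenerate cases `x_a = ∅` / `x_b = ∅` and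
otherwise obtained by the projection-preserving normalisation `E ↦ E ⊕ 𝟙(g_{ba})` — and FGL's flip `x_a ⊎ x_b ⊆ E` never
enlarges anything. Counting steps (each removes `≥ κ₀ = β̃·max Δ` syndrome bits by the max-ratio rule and adds `≤ 1` column /
`≤ 1` row to the projections) gives the invariant `|E_A²(ε)| + |σ_X(ε)|/κ₀ ≤ γ_A n_A` (and its `B` twin), hence the radius
`|e|(1 + 1/β̃) ≤ min(γ_A n_A, γ_B n_B)` with no `r̃`:

* `beta_mul_card_critFlip_le_decrease` — Lemma 24 LOCALLY (any word, local minimality inequality as hypothesis);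
* `exists_flip_beta_of_proj` — a flip of ratio `≥ β̃·max Δ` for every NON-HARMLESS word with small projections;
* `mem_rowSpace_of_syndrome_eq_zero_of_proj_beta` — its contrapositive at zero syndrome (`β̃ > 0`, `δ ≥ 0`; no `δ < 1/6`);
* `ssfRun_corrects_of_proj_beta` — the run invariant for every threshold `κ ≤ β̃·max Δ` (Remark 9 is built in: by the
  max-ratio rule each actual step has ratio `≥ β̃·max Δ` as soon as some flip does);
* ★ `fgl18_proposition11_proj` — every small-set-flip decoder with `κ ≤ β̃·max(Δ_A,Δ_B)` corrects every `X`-error with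
  `|e| ≤ (β̃/(1+β̃))·min(γ_A n_A, γ_B n_B)`. The printed radius as a corollary, the `Z`-sector and the instantiation on the
  tree's expander family (both sectors, unbalanced degrees included) are in `QuantumExpanderProp11ProjectionFamily.lean`.

STATUS / HONEST FRAMING: OURS as a statement only for UNBALANCED degrees (for `Δ_A = Δ_B` the radius IS the printed one) and
for the boundary `δ ≥ 0` in place of `δ > 0`; the proof device (projection invariant) is the one of
`QuantumExpanderRobustnessProjection.lean`. PROVED (kernel axioms); no definitions, no named facts.
-/

namespace Summit.Ventures.QEC.Expanders

open Finset Matrix Literature.InformationTheory.QuantumCodes Literature.InformationTheory.QuantumCodes.QuantumExpander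

variable {A B : Type*} [Fintype A] [Fintype B] [DecidableEq A] [DecidableEq B]

/-! ### Lemma 24, locally -/

/-- **FGL18 Lemma 24 LOCALLY**: for ANY word `e`, any critical generator `g_{ba}` for its support at which the local
`‖·‖`-minimality inequality `Δ_A|x_a| + Δ_B|x_b| ≤ Δ_AΔ_B` holds ("`‖x_a‖ + ‖x_b‖ ≤ 1`"), the flip `F = x_a ⊎ x_b` has
`β̃·max(Δ_A,Δ_B)·|F| ≤ |σ_X(e)| − |σ_X(e ⊕ 𝟙_F)|` (`β̃ = betaZero (min Δ) (max Δ) δ_A δ_B > 0`). The arithmetic is the tree's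
`key_ineq_min`; no reducedness of `e` is assumed. [cite: FawziGrospellierLeverrier2018, Lemma 24 proof (§7.1, arXiv v2 p0018 L70-130)] -/
theorem beta_mul_card_critFlip_le_decrease (H : Matrix B A (ZMod 2)) {dA dB : ℕ} {δA δB : ℝ}
    (hreg : IsBiregular H dA dB) (hdA : 0 < dA) (hdB : 0 < dB)
    (hβ : 0 < betaZero (min dA dB) (max dA dB) δA δB)
    {e : (A × A) ⊕ (B × B) → ZMod 2} {b : B} {a : A} {Χa : Finset A} {Χb : Finset B}
    (hc : IsCritical H dA dB δA δB (supp e) b a Χa Χb)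
    (hmin' : dA * (critX H e b a Χa).card + dB * (critY H e b a Χb).card ≤ dA * dB) :
    betaZero (min dA dB) (max dA dB) δA δB * ((max dA dB : ℕ) : ℝ) * (critFlip H e b a Χa Χb).card
      ≤ (syndromeDecrease (expanderHX H) (expanderHX H *ᵥ e) (critFlip H e b a Χa Χb) : ℝ) := by
  have hdec := syndromeDecrease_critFlip_ge hreg hc
  have hF : ((critFlip H e b a Χa Χb).card : ℝ)
      = (critX H e b a Χa).card + (critY H e b a Χb).card := by
    exact_mod_cast card_critFlip H e b a Χa Χb
  rw [hF]
  have hdA' : (0 : ℝ) < dA := by exact_mod_cast hdA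
  have hdB' : (0 : ℝ) < dB := by exact_mod_cast hdB
  have hdm0 : 0 < min dA dB := lt_min hdA hdB
  have hdM0 : 0 < max dA dB := lt_max_of_lt_left hdA
  have hcpos : 0 < 1 - 4 * (δA + δB + (δB - δA) ^ 2) :=
    (betaZero_pos_iff hdm0 hdM0 δA δB).1 hβ
  have hkey := key_ineq_min (X := ((critX H e b a Χa).card : ℝ)) (Y := ((critY H e b a Χb).card : ℝ))
    (za := (Χa.card : ℝ)) (zb := (Χb.card : ℝ)) hdA' hdB' (Nat.cast_nonneg _)
    (Nat.cast_nonneg _) hc.card_Χa_le hc.card_Χb_le (by exact_mod_cast hmin') hcpos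
  have hdecR : ((critX H e b a Χa).card : ℝ) * ((dA : ℝ) - Χb.card - (critY H e b a Χb).card)
      + ((dB : ℝ) - Χa.card - (critX H e b a Χa).card) * (critY H e b a Χb).card
      - (critX H e b a Χa).card * Χb.card - Χa.card * (critY H e b a Χb).card
      ≤ (syndromeDecrease (expanderHX H) (expanderHX H *ᵥ e) (critFlip H e b a Χa Χb) : ℝ) := by
    exact_mod_cast hdec
  have hβc : betaZero (min dA dB) (max dA dB) δA δB * ((max dA dB : ℕ) : ℝ)
      = (1 - 4 * (δA + δB + (δB - δA) ^ 2)) / 2 * min (dA : ℝ) (dB : ℝ) := by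
    have hmincast : (min (dA : ℝ) (dB : ℝ)) = ((min dA dB : ℕ) : ℝ) := by rw [Nat.cast_min]
    rw [hmincast]
    have hM' : (0 : ℝ) < ((max dA dB : ℕ) : ℝ) := by exact_mod_cast hdM0
    unfold betaZero
    field_simp
  rw [hβc]
  linarith

/-- The local minimality inequality from local `‖·‖`-minimality at the generator: if `‖e‖ ≤ ‖e ⊕ 𝟙(g_{ba})‖` (weighted
size `wnorm`) then `Δ_A|x_a| + Δ_B|x_b| ≤ Δ_AΔ_B`. [cite: FawziGrospellierLeverrier2018, Lemma 24 proof ("x + y ≤ 1 because E_R minimizes ‖·‖"; arXiv v2 p0018 L81)] -/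
theorem critX_critY_le_of_wnorm_le (H : Matrix B A (ZMod 2)) {dA dB : ℕ} (hreg : IsBiregular H dA dB)
    (e : (A × A) ⊕ (B × B) → ZMod 2) (b : B) (a : A) (Χa : Finset A) (Χb : Finset B)
    (hloc : wnorm dA dB e ≤ wnorm dA dB (e + expanderHZ H (b, a))) :
    dA * (critX H e b a Χa).card + dB * (critY H e b a Χb).card ≤ dA * dB := by
  have hrow := wnorm_add_row H hreg e b a
  have hXle : (critX H e b a Χa).card ≤ ((nbrs Hᵀ b).filter fun α => e (Sum.inl (α, a)) ≠ 0).card := by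
    refine Finset.card_le_card fun α hα => ?_
    rw [mem_critX] at hα
    rw [Finset.mem_filter, mem_nbrs, Matrix.transpose_apply]
    exact ⟨hα.1.1, hα.2⟩
  have hYle : (critY H e b a Χb).card ≤ ((nbrs H a).filter fun β => e (Sum.inr (b, β)) ≠ 0).card := by
    refine Finset.card_le_card fun β hβ => ?_
    rw [mem_critY] at hβ
    rw [Finset.mem_filter, mem_nbrs]
    exact ⟨hβ.1.1, hβ.2⟩
  have hX' := Nat.mul_le_mul_left dA hXle
  have hY' := Nat.mul_le_mul_left dB hYle
  linarith

/-- In the degenerate cases `x_a = ∅` or `x_b = ∅` the local inequality is automatic (`|x_a| ≤ Δ_B`, `|x_b| ≤ Δ_A`).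
[cite: FawziGrospellierLeverrier2018, Lemma 24 proof (0 ≤ ‖x_a‖, ‖x_b‖ ≤ 1; arXiv v2 p0018 L105)] -/
theorem critX_critY_le_of_degenerate (H : Matrix B A (ZMod 2)) {dA dB : ℕ} (hreg : IsBiregular H dA dB)
    (e : (A × A) ⊕ (B × B) → ZMod 2) (b : B) (a : A) (Χa : Finset A) (Χb : Finset B)
    (hdeg : critX H e b a Χa = ∅ ∨ critY H e b a Χb = ∅) :
    dA * (critX H e b a Χa).card + dB * (critY H e b a Χb).card ≤ dA * dB := by
  have hXle : (critX H e b a Χa).card ≤ dB := by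
    have h1 : critX H e b a Χa ⊆ nbrs Hᵀ b := fun α hα =>
      (Finset.mem_sdiff.1 (Finset.mem_filter.1 hα).1).1
    have := Finset.card_le_card h1
    rwa [card_nbrs_transpose_eq H hreg b] at this
  have hYle : (critY H e b a Χb).card ≤ dA := by
    have h1 : critY H e b a Χb ⊆ nbrs H a := fun β hβ =>
      (Finset.mem_sdiff.1 (Finset.mem_filter.1 hβ).1).1
    have := Finset.card_le_card h1
    rwa [card_nbrs_eq H hreg a] at this
  rcases hdeg with h | h
  · rw [h, Finset.card_empty, mul_zero, zero_add]
    calc dB * (critY H e b a Χb).card ≤ dB * dA := Nat.mul_le_mul_left _ hYle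
      _ = dA * dB := mul_comm _ _
  · rw [h, Finset.card_empty, mul_zero, add_zero]
    exact Nat.mul_le_mul_left _ hXle

/-! ### A flip of ratio `≥ β̃·max Δ` for every non-harmless word with small projections -/

/-- **FGL18 Lemma 24 for every NON-HARMLESS word with small projections** (no reducedness, no weight bound): for a
`(Δ_A,Δ_B)`-biregular `(γ_A,δ_A,γ_B,δ_B)`-expander with `β̃ > 0` and `δ_A, δ_B ≥ 0`, every `e ∉ C_Z^⊥` with `|E_A²| ≤ γ_A n_A`,
`|π₁(E∩B²)| ≤ γ_B n_B` admits a small set `F` with `β̃·max(Δ_A,Δ_B)·|F| ≤ |σ_X(e)| − |σ_X(e ⊕ 𝟙_F)|`. Induction on `‖e‖`: at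
a critical generator (`exists_isCritical_of_proj`) the local inequality holds in the degenerate cases and under local
`‖·‖`-minimality; otherwise `e ⊕ 𝟙(g_{ba})` is a non-harmless word of the same syndrome, smaller `‖·‖` and no larger
projections. STATUS: OURS in this generality. [cite: FawziGrospellierLeverrier2018, Lemma 24 (§7.1, arXiv v2 p0018 L36-130)] -/
theorem exists_flip_beta_of_proj (H : Matrix B A (ZMod 2)) {dA dB : ℕ} {γA δA γB δB : ℝ}
    (hreg : IsBiregular H dA dB) (hexp : IsLeftRightExpanding H dA dB γA δA γB δB)
    (hdA : 0 < dA) (hdB : 0 < dB) (hδA : 0 ≤ δA) (hδB : 0 ≤ δB)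
    (hβ : 0 < betaZero (min dA dB) (max dA dB) δA δB)
    (e : (A × A) ⊕ (B × B) → ZMod 2) (he : e ∉ rowSpace (expanderHZ H))
    (heA : ((projA (supp e)).card : ℝ) ≤ γA * Fintype.card A)
    (heB : ((projB (supp e)).card : ℝ) ≤ γB * Fintype.card B) :
    ∃ F ∈ smallSets (expanderHZ H),
      betaZero (min dA dB) (max dA dB) δA δB * ((max dA dB : ℕ) : ℝ) * F.card
        ≤ (syndromeDecrease (expanderHX H) (expanderHX H *ᵥ e) F : ℝ) := by
  classical
  suffices h : ∀ n : ℕ, ∀ f : (A × A) ⊕ (B × B) → ZMod 2, wnorm dA dB f ≤ n →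
      f ∉ rowSpace (expanderHZ H) →
      ((projA (supp f)).card : ℝ) ≤ γA * Fintype.card A →
      ((projB (supp f)).card : ℝ) ≤ γB * Fintype.card B →
      ∃ F ∈ smallSets (expanderHZ H),
        betaZero (min dA dB) (max dA dB) δA δB * ((max dA dB : ℕ) : ℝ) * F.card
          ≤ (syndromeDecrease (expanderHX H) (expanderHX H *ᵥ f) F : ℝ) from
    h _ e le_rfl he heA heB
  intro n
  induction n using Nat.strong_induction_on with
  | _ n ih =>
    intro f hf hfns hfA hfB
    have hfz : f ≠ 0 := by
      intro h0; exact hfns (by rw [h0]; exact Submodule.zero_mem _)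
    have hE0 : (supp f).Nonempty := by
      by_contra h0
      rw [Finset.not_nonempty_iff_eq_empty] at h0
      apply hfz
      ext q
      by_contra hq
      have : q ∈ supp f := by simpa [supp] using hq
      rw [h0] at this
      exact Finset.notMem_empty _ this
    obtain ⟨b, a, Χa, Χb, hc⟩ := exists_isCritical_of_proj H hreg hexp hdA hdB hδA hδB (supp f) hE0 hfA hfB
    by_cases hdeg : critX H f b a Χa = ∅ ∨ critY H f b a Χb = ∅
    · exact ⟨critFlip H f b a Χa Χb, critFlip_mem_smallSets hc,
        beta_mul_card_critFlip_le_decrease H hreg hdA hdB hβ hc (critX_critY_le_of_degenerate H hreg f b a Χa Χb hdeg)⟩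
    · rw [not_or] at hdeg
      have haP : a ∈ projA (supp f) :=
        mem_projA_of_critX_nonempty (Finset.nonempty_iff_ne_empty.2 hdeg.1)
      have hbP : b ∈ projB (supp f) :=
        mem_projB_of_critY_nonempty (Finset.nonempty_iff_ne_empty.2 hdeg.2)
      by_cases hloc : wnorm dA dB f ≤ wnorm dA dB (f + expanderHZ H (b, a))
      · exact ⟨critFlip H f b a Χa Χb, critFlip_mem_smallSets hc,
          beta_mul_card_critFlip_le_decrease H hreg hdA hdB hβ hc (critX_critY_le_of_wnorm_le H hreg f b a Χa Χb hloc)⟩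
      · push Not at hloc
        set g : (A × A) ⊕ (B × B) → ZMod 2 := expanderHZ H (b, a) with hg
        have hgmem : g ∈ rowSpace (expanderHZ H) := expanderHZ_row_mem_rowSpace H b a
        have hsyn : expanderHX H *ᵥ (f + g) = expanderHX H *ᵥ f := by
          rw [Matrix.mulVec_add, expanderHX_mulVec_eq_zero_of_mem_rowSpace H hgmem, add_zero]
        have hns' : f + g ∉ rowSpace (expanderHZ H) := by
          intro hmem
          apply hfns
          have : f = (f + g) - g := by abel
          rw [this]
          exact Submodule.sub_mem _ hmem hgmem
        have hsuppg : supp g ⊆ genSupport (expanderHZ H) (b, a) := by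
          intro q hq; simpa [supp, genSupport] using hq
        have hA' : projA (supp (f + g)) ⊆ projA (supp f) := by
          rw [← Finset.insert_eq_of_mem haP]; exact projA_supp_add_subset H f g b a hsuppg
        have hB' : projB (supp (f + g)) ⊆ projB (supp f) := by
          rw [← Finset.insert_eq_of_mem hbP]; exact projB_supp_add_subset H f g b a hsuppg
        obtain ⟨F, hFs, hF3⟩ := ih (wnorm dA dB (f + g)) (by omega) (f + g) le_rfl hns'
          (le_trans (by exact_mod_cast Finset.card_le_card hA') hfA)
          (le_trans (by exact_mod_cast Finset.card_le_card hB') hfB)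
        exact ⟨F, hFs, by rw [hsyn] at hF3; exact hF3⟩

/-- **Zero syndrome + small projections ⇒ stabilizer element, under `β̃ > 0`** (contrapositive of
`exists_flip_beta_of_proj`: a flip of positive decrease cannot exist at syndrome `0`). Compare
`mem_rowSpace_of_syndrome_eq_zero_of_proj` (same conclusion under `δ < 1/6`). STATUS: OURS.
[cite: FawziGrospellierLeverrier2018, proof of Prop 11, last step ("E_f is harmless", arXiv v2 p0019 L3-6)] -/
theorem mem_rowSpace_of_syndrome_eq_zero_of_proj_beta (H : Matrix B A (ZMod 2)) {dA dB : ℕ} {γA δA γB δB : ℝ}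
    (hreg : IsBiregular H dA dB) (hexp : IsLeftRightExpanding H dA dB γA δA γB δB)
    (hdA : 0 < dA) (hdB : 0 < dB) (hδA : 0 ≤ δA) (hδB : 0 ≤ δB)
    (hβ : 0 < betaZero (min dA dB) (max dA dB) δA δB)
    {e : (A × A) ⊕ (B × B) → ZMod 2} (hσ : expanderHX H *ᵥ e = 0)
    (hA : ((projA (supp e)).card : ℝ) ≤ γA * Fintype.card A)
    (hB : ((projB (supp e)).card : ℝ) ≤ γB * Fintype.card B) :
    e ∈ rowSpace (expanderHZ H) := by
  by_contra hnot
  obtain ⟨F, hF, hFdec⟩ := exists_flip_beta_of_proj H hreg hexp hdA hdB hδA hδB hβ e hnot hA hB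
  have hFpos : (0 : ℝ) < F.card := by exact_mod_cast card_pos_of_mem_smallSets hF
  have hdM : (0 : ℝ) < ((max dA dB : ℕ) : ℝ) := by exact_mod_cast lt_max_of_lt_left hdA
  have hpos : (0 : ℝ) < syndromeDecrease (expanderHX H) (expanderHX H *ᵥ e) F :=
    lt_of_lt_of_le (mul_pos (mul_pos hβ hdM) hFpos) hFdec
  have hle : syndromeDecrease (expanderHX H) (expanderHX H *ᵥ e) F ≤ 0 := by
    rw [syndromeDecrease, hσ]; simp
  have : (syndromeDecrease (expanderHX H) (expanderHX H *ᵥ e) F : ℝ) ≤ 0 := by exact_mod_cast hle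
  linarith

/-! ### The run invariant with `κ₀ = β̃·max Δ` steps -/

/-- **The run invariant (ours): along every complete run of ANY small-set-flip decoder with threshold `κ ≤ κ₀ = β̃·max Δ`
from `σ_X(ε)`, the quantity `|E_A²(ε)| + |σ_X(ε)|/κ₀` (and its `B` twin) never increases**, because at a state with small
projections a flip of ratio `≥ κ₀` exists (`exists_flip_beta_of_proj`), so by the max-ratio rule the chosen flip has ratio
`≥ κ₀` too (this is where Remark 9 enters) and removes `≥ κ₀|F| ≥ κ₀` syndrome bits while adding at most one column / row;
hence if initially `|E_A²| + |σ_X|/κ₀ ≤ γ_A n_A` and `|π₁(E∩B²)| + |σ_X|/κ₀ ≤ γ_B n_B`, the run ends with `ε ⊕ Ê ∈ C_Z^⊥`.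
[cite: FawziGrospellierLeverrier2018, proof of Prop 11 (§7.1, arXiv v2 p0018 L131 – p0019 L6) and Remark 9 (p0011 L1-2)] -/
theorem ssfRun_corrects_of_proj_beta (H : Matrix B A (ZMod 2)) {dA dB : ℕ} {γA δA γB δB : ℝ}
    (hreg : IsBiregular H dA dB) (hexp : IsLeftRightExpanding H dA dB γA δA γB δB)
    (hdA : 0 < dA) (hdB : 0 < dB) (hδA : 0 ≤ δA) (hδB : 0 ≤ δB)
    (hβ : 0 < betaZero (min dA dB) (max dA dB) δA δB)
    {κ : ℝ} (hκ : κ ≤ betaZero (min dA dB) (max dA dB) δA δB * ((max dA dB : ℕ) : ℝ))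
    {σ : A × B → ZMod 2} {l : List (Finset ((A × A) ⊕ (B × B)))}
    (hrun : IsSSFRun κ (expanderHX H) (expanderHZ H) σ l) :
    ∀ ε : (A × A) ⊕ (B × B) → ZMod 2, expanderHX H *ᵥ ε = σ →
      ((projA (supp ε)).card : ℝ) + hammingNorm σ / (betaZero (min dA dB) (max dA dB) δA δB * ((max dA dB : ℕ) : ℝ))
          ≤ γA * Fintype.card A →
      ((projB (supp ε)).card : ℝ) + hammingNorm σ / (betaZero (min dA dB) (max dA dB) δA δB * ((max dA dB : ℕ) : ℝ))
          ≤ γB * Fintype.card B →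
      ε + runOutput l ∈ rowSpace (expanderHZ H) := by
  classical
  set κ₀ : ℝ := betaZero (min dA dB) (max dA dB) δA δB * ((max dA dB : ℕ) : ℝ) with hκ₀
  have hdM : (0 : ℝ) < ((max dA dB : ℕ) : ℝ) := by exact_mod_cast lt_max_of_lt_left hdA
  have hκ₀pos : 0 < κ₀ := mul_pos hβ hdM
  induction hrun with
  | @halt σ hh =>
    intro ε hε hA hB
    have hout : runOutput ([] : List (Finset ((A × A) ⊕ (B × B)))) = 0 := by simp [runOutput]
    rw [hout, add_zero]
    have hσ0 : (0 : ℝ) ≤ hammingNorm σ / κ₀ := div_nonneg (Nat.cast_nonneg _) hκ₀pos.le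
    have hA' : ((projA (supp ε)).card : ℝ) ≤ γA * Fintype.card A := by linarith
    have hB' : ((projB (supp ε)).card : ℝ) ≤ γB * Fintype.card B := by linarith
    by_contra hnot
    obtain ⟨F, hF, hFdec⟩ := exists_flip_beta_of_proj H hreg hexp hdA hdB hδA hδB hβ ε hnot hA' hB'
    rw [hε] at hFdec
    have hFpos : (0 : ℝ) < F.card := by exact_mod_cast card_pos_of_mem_smallSets hF
    have hdposR : (0 : ℝ) < syndromeDecrease (expanderHX H) σ F :=
      lt_of_lt_of_le (mul_pos hκ₀pos hFpos) hFdec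
    have hdpos : 0 < syndromeDecrease (expanderHX H) σ F := by exact_mod_cast hdposR
    refine hh F hF ⟨hdpos, ?_⟩
    have : κ * F.card ≤ κ₀ * F.card := mul_le_mul_of_nonneg_right hκ hFpos.le
    linarith
  | @step σ F l hF hrest ih =>
    intro ε hε hA hB
    obtain ⟨hFmem, hdecpos, _, hmax⟩ := hF
    obtain ⟨b, a, hFg⟩ := exists_subset_genSupport_of_mem_smallSets hFmem
    have hσ0 : (0 : ℝ) ≤ hammingNorm σ / κ₀ := div_nonneg (Nat.cast_nonneg _) hκ₀pos.le
    have hA' : ((projA (supp ε)).card : ℝ) ≤ γA * Fintype.card A := by linarith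
    have hB' : ((projB (supp ε)).card : ℝ) ≤ γB * Fintype.card B := by linarith
    -- `ε` is not harmless (a flip decreased its syndrome), so a flip of ratio `≥ κ₀` exists; by maximality so has `F`
    have hnot : ε ∉ rowSpace (expanderHZ H) := by
      intro hmem
      have hσz : σ = 0 := by rw [← hε]; exact expanderHX_mulVec_eq_zero_of_mem_rowSpace H hmem
      have : syndromeDecrease (expanderHX H) σ F ≤ 0 := by rw [syndromeDecrease, hσz]; simp
      linarith
    obtain ⟨F', hF', hdec'⟩ := exists_flip_beta_of_proj H hreg hexp hdA hdB hδA hδB hβ ε hnot hA' hB'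
    rw [hε] at hdec'
    have hratio := hmax F' hF'
    have hF'pos : (0 : ℝ) < F'.card := by exact_mod_cast card_pos_of_mem_smallSets hF'
    have hFpos : (0 : ℝ) < F.card := by exact_mod_cast card_pos_of_mem_smallSets hFmem
    have hκ₀F : κ₀ * F.card ≤ (syndromeDecrease (expanderHX H) σ F : ℝ) := by
      have h1 : κ₀ ≤ (syndromeDecrease (expanderHX H) σ F' : ℝ) / F'.card := by
        rw [le_div_iff₀ hF'pos]; exact hdec'
      have h2 := h1.trans hratio
      rwa [le_div_iff₀ hFpos] at h2
    have hF1 : (1 : ℝ) ≤ F.card := by exact_mod_cast card_pos_of_mem_smallSets hFmem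
    -- the new word and the invariant
    have hε' : expanderHX H *ᵥ (ε + flipVec F) = σ + expanderHX H *ᵥ flipVec F := by
      rw [Matrix.mulVec_add, hε]
    have hdec : (hammingNorm (σ + expanderHX H *ᵥ flipVec F) : ℝ) / κ₀ + 1 ≤ hammingNorm σ / κ₀ := by
      have h2 : (syndromeDecrease (expanderHX H) σ F : ℝ)
          = hammingNorm σ - hammingNorm (σ + expanderHX H *ᵥ flipVec F) := by
        rw [syndromeDecrease]; push_cast; ring
      rw [h2] at hκ₀F
      have h3 : κ₀ ≤ (hammingNorm σ : ℝ) - hammingNorm (σ + expanderHX H *ᵥ flipVec F) := by nlinarith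
      rw [div_add_one hκ₀pos.ne', div_le_div_iff_of_pos_right hκ₀pos]
      linarith
    have hsuppF : supp (flipVec F) ⊆ genSupport (expanderHZ H) (b, a) := by rw [supp_flipVec]; exact hFg
    have hA1 : ((projA (supp (ε + flipVec F))).card : ℝ) ≤ (projA (supp ε)).card + 1 := by
      have h1 := Finset.card_le_card (projA_supp_add_subset H ε (flipVec F) b a hsuppF)
      have h2 := Finset.card_insert_le a (projA (supp ε))
      exact_mod_cast h1.trans h2
    have hB1 : ((projB (supp (ε + flipVec F))).card : ℝ) ≤ (projB (supp ε)).card + 1 := by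
      have h1 := Finset.card_le_card (projB_supp_add_subset H ε (flipVec F) b a hsuppF)
      have h2 := Finset.card_insert_le b (projB (supp ε))
      exact_mod_cast h1.trans h2
    have hres := ih (ε + flipVec F) hε' (by linarith) (by linarith)
    rw [runOutput_cons, ← add_assoc]
    exact hres

/-- **FGL18 Proposition 11, projection form**: every small-set-flip decoder with threshold `κ ≤ β̃·max(Δ_A,Δ_B)` corrects
every `X`-error `e` with `|E_A²| + |σ_X(e)|/(β̃·max Δ) ≤ γ_A n_A` and `|π₁(E∩B²)| + |σ_X(e)|/(β̃·max Δ) ≤ γ_B n_B` (`β̃ > 0`,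
`δ ≥ 0`, biregular). STATUS: OURS. [cite: FawziGrospellierLeverrier2018, Prop 11 (§3.2, arXiv v2 p0011 L4-24)] -/
theorem ssfDecoder_corrects_of_proj_beta (H : Matrix B A (ZMod 2)) {dA dB : ℕ} {γA δA γB δB : ℝ}
    (hreg : IsBiregular H dA dB) (hexp : IsLeftRightExpanding H dA dB γA δA γB δB)
    (hdA : 0 < dA) (hdB : 0 < dB) (hδA : 0 ≤ δA) (hδB : 0 ≤ δB)
    (hβ : 0 < betaZero (min dA dB) (max dA dB) δA δB)
    {κ : ℝ} (hκ : κ ≤ betaZero (min dA dB) (max dA dB) δA δB * ((max dA dB : ℕ) : ℝ))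
    (D : Decoder (A × B → ZMod 2) ((A × A) ⊕ (B × B) → ZMod 2))
    (hD : IsSSFDecoder κ (expanderHX H) (expanderHZ H) D) (e : (A × A) ⊕ (B × B) → ZMod 2)
    (heA : ((projA (supp e)).card : ℝ)
      + hammingNorm (expanderHX H *ᵥ e) / (betaZero (min dA dB) (max dA dB) δA δB * ((max dA dB : ℕ) : ℝ))
        ≤ γA * Fintype.card A)
    (heB : ((projB (supp e)).card : ℝ)
      + hammingNorm (expanderHX H *ᵥ e) / (betaZero (min dA dB) (max dA dB) δA δB * ((max dA dB : ℕ) : ℝ))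
        ≤ γB * Fintype.card B) :
    D.Corrects (fun x => expanderHX H *ᵥ x) (rowSpace (expanderHZ H) : Set _) e := by
  classical
  obtain ⟨l, hrun, hDσ⟩ := hD (expanderHX H *ᵥ e)
  rw [Decoder.Corrects, hDσ, SetLike.mem_coe, add_comm]
  exact ssfRun_corrects_of_proj_beta H hreg hexp hdA hdB hδA hδB hβ hκ hrun e rfl heA heB

/-- ★ **FGL18 Proposition 11 WITHOUT the degree-ratio factor**: for a `(Δ_A,Δ_B)`-biregular `(γ_A,δ_A,γ_B,δ_B)`-expander with
`β̃ = betaZero (min Δ) (max Δ) δ_A δ_B > 0` and `δ_A, δ_B ≥ 0`, EVERY small-set-flip decoder with threshold `κ ≤ β̃·max(Δ_A,Δ_B)`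
(Algorithm 1 included) corrects EVERY `X`-error of weight `≤ (β̃/(1+β̃))·min(γ_A n_A, γ_B n_B)`. The printed radius (and the
tree's `fgl18_proposition11_minmax_of_le`) is `(min Δ/max Δ)` times this one; they coincide for `Δ_A = Δ_B`. Proof:
`|E_A²|, |π₁(E∩B²)| ≤ |e|`, `|σ_X(e)| ≤ max Δ·|e|`, so both invariants start at `≤ |e|(1 + 1/β̃) ≤ min(γ_A n_A, γ_B n_B)`.
STATUS: OURS for unbalanced degrees (statement) / for the proof device; the printed statement for balanced degrees.
[cite: FawziGrospellierLeverrier2018, Def 10, Prop 11, Remark 9 (§3.2, arXiv v2 p0011 L1-24)] -/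
theorem fgl18_proposition11_proj (H : Matrix B A (ZMod 2)) {dA dB : ℕ} {γA δA γB δB : ℝ}
    (hreg : IsBiregular H dA dB) (hexp : IsLeftRightExpanding H dA dB γA δA γB δB)
    (hdA : 0 < dA) (hdB : 0 < dB) (hδA : 0 ≤ δA) (hδB : 0 ≤ δB)
    (hβ : 0 < betaZero (min dA dB) (max dA dB) δA δB)
    {κ : ℝ} (hκ : κ ≤ betaZero (min dA dB) (max dA dB) δA δB * ((max dA dB : ℕ) : ℝ))
    (D : Decoder (A × B → ZMod 2) ((A × A) ⊕ (B × B) → ZMod 2))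
    (hD : IsSSFDecoder κ (expanderHX H) (expanderHZ H) D) (e : (A × A) ⊕ (B × B) → ZMod 2)
    (he : (hammingNorm e : ℝ) ≤
      betaZero (min dA dB) (max dA dB) δA δB / (1 + betaZero (min dA dB) (max dA dB) δA δB)
        * min (γA * Fintype.card A) (γB * Fintype.card B)) :
    D.Corrects (fun x => expanderHX H *ᵥ x) (rowSpace (expanderHZ H) : Set _) e := by
  classical
  set β : ℝ := betaZero (min dA dB) (max dA dB) δA δB with hβdef
  set dM : ℝ := ((max dA dB : ℕ) : ℝ) with hdMdef
  have hdM : 0 < dM := by rw [hdMdef]; exact_mod_cast lt_max_of_lt_left hdA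
  have hsupp : (supp e).card = hammingNorm e := by simp [supp, hammingNorm]
  have hσ : (hammingNorm (expanderHX H *ᵥ e) : ℝ) ≤ dM * hammingNorm e := by
    rw [hdMdef]; exact_mod_cast hammingNorm_expanderHX_mulVec_le_max H hreg e
  have hpA : ((projA (supp e)).card : ℝ) ≤ hammingNorm e := by
    rw [← hsupp]; exact_mod_cast card_projA_le (supp e)
  have hpB : ((projB (supp e)).card : ℝ) ≤ hammingNorm e := by
    rw [← hsupp]; exact_mod_cast card_projB_le (supp e)
  -- `|σ_X(e)|/(β̃ max) ≤ |e|/β̃`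
  have hdiv : (hammingNorm (expanderHX H *ᵥ e) : ℝ) / (β * dM) ≤ hammingNorm e / β := by
    rw [div_le_div_iff₀ (mul_pos hβ hdM) hβ]
    nlinarith
  -- `|e| + |e|/β̃ ≤ min` from `|e| ≤ (β̃/(1+β̃))·min`
  set M := min (γA * Fintype.card A) (γB * Fintype.card B) with hM
  have h1b : 0 < 1 + β := by linarith
  have hkey : (hammingNorm e : ℝ) + hammingNorm e / β ≤ M := by
    have h1 : (hammingNorm e : ℝ) * (1 + β) ≤ β * M := by
      have h := he
      rw [div_mul_eq_mul_div, le_div_iff₀ h1b] at h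
      exact h
    have hrew : (hammingNorm e : ℝ) + hammingNorm e / β = hammingNorm e * (1 + β) / β := by
      field_simp
      ring
    rw [hrew, div_le_iff₀ hβ]
    linarith
  refine ssfDecoder_corrects_of_proj_beta H hreg hexp hdA hdB hδA hδB hβ hκ D hD e ?_ ?_
  · have := min_le_left (γA * Fintype.card A) (γB * Fintype.card B)
    linarith
  · have := min_le_right (γA * Fintype.card A) (γB * Fintype.card B)
    linarith

end Summit.Ventures.QEC.Expanders
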